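import Literature.Barriers.FinalStateConjecture.KleinGordonHorizonFlux
import HarnessLib

/-!
# Barrier catalogue `FinalStateConjecture`: Shlapentokh-Rothman's unstable Klein–Gordon modes —
# the horizon value of the energy current, `Q_T(r₊) = (am − 2Mr₊ω)|f(r₊)|²`
(`Literature/Barriers/FinalStateConjecture/`, D-0021, D-0014; family `gr`; namespace
`Literature.Barriers.FinalStateConjecture`)

Shlapentokh-Rothman, Comm. Math. Phys. 329 (2014), §3.1: for a solution of the radial ODE of the
horizon form (2.3)–(2.4), `R = e^{-i(ωt̄ - mφ̄)} f` with `f` regular at `r₊`, and REAL `ω`, the energy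
current satisfies `Q_T(r₊) = (2Mr₊) Im(dR/dr*(r₊) \overline{R(r₊)}) = (am − 2Mr₊ω)|R(r₊)|²`
(display after "using the horizon boundary condition (2.4)", held copy p. 8; used again in §4.3,
p. 11: "`Q_T(r₊) = am − 2Mr₊ω_R`" with the normalisation `|R(r₊)|² = 1`). Here, continuing
`KleinGordonHorizonFlux.lean` (the case `Im ω > 0`, where the limit is `0`):

* `tendsto_horizonFlux_of_horizonForm_real` — for `Im ω = 0`,
  `Δ R' R̄ → -i(ω(r₊² + a²) − am)|f(r₊)|²` as `r → r₊⁺`;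
* `tendsto_im_horizonFlux_of_horizonForm_real` — hence
  `Im(Δ R' R̄) → (am − 2Mr₊ Re ω)|f(r₊)|²` (`r₊² + a² = 2Mr₊`).

Everything is proved; no named facts.

## References

* Y. Shlapentokh-Rothman, Comm. Math. Phys. 329 (2014) 859–891, arXiv:1302.3448: §2 (2.3)–(2.4),
  §3.1, §4.3 (held copy `paper:arxiv-1302.3448`, pp. 7, 8, 11). Key `ShlapentokhRothman2014KleinGordon`.
-/

noncomputable section

open Set Filter
open scoped Topology Real ContDiff ComplexConjugate

namespace Literature.Barriers.FinalStateConjecture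

open Literature.Geometry.Lorentzian

variable {M a : ℝ}

/-- **The horizon flux for real `ω`.** Let `(M, a)` be sub-extremal, `Im ω = 0`, and let
`R = e^{-i(ωt̄ - mφ̄)} f` on `(r₊, ∞)` with `f` of class `C¹` on `(r₊ - η, ∞)`, `η > 0`. Then
`Δ R' R̄ → -i (ω(r₊² + a²) − am) |f(r₊)|²` as `r → r₊⁺` (`|e^{-i(ωt̄ - mφ̄)}| = 1`,
`Δ R' R̄ = (Δ f' − iKf) f̄`, `K = ω(r² + a²) − am`, `Δ(r₊) = 0`).
[cite: ShlapentokhRothman2014KleinGordon, §3.1] -/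
theorem tendsto_horizonFlux_of_horizonForm_real (hMa : Kerr.IsSubextremal M a) {w : ℂ}
    (hw : w.im = 0) (m : ℤ) {R f : ℝ → ℂ} {η : ℝ} (hη : 0 < η)
    (hf : ContDiffOn ℝ 1 f (Ioi (Kerr.rPlus M a - η)))
    (hRf : ∀ r ∈ Ioi (Kerr.rPlus M a), R r =
      Complex.exp (-(Complex.I * (w * ((Kerr.starTime M a r : ℝ) : ℂ) -
        (m : ℂ) * ((Kerr.starAngle M a r : ℝ) : ℂ)))) * f r) :
    Tendsto (fun r : ℝ ↦ ((Kerr.delta M a r : ℝ) : ℂ) * deriv R r * conj (R r))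
      (𝓝[>] (Kerr.rPlus M a))
      (𝓝 (-(Complex.I * (w * (((Kerr.rPlus M a ^ 2 + a ^ 2 : ℝ)) : ℂ) - (m : ℂ) * (a : ℂ))) *
        ((‖f (Kerr.rPlus M a)‖ ^ 2 : ℝ) : ℂ))) := by
  set rp := Kerr.rPlus M a with hrp
  -- the phase and its derivative on `(r₊, ∞)`
  set P : ℝ → ℂ := fun r ↦ Complex.exp (-(Complex.I * (w * ((Kerr.starTime M a r : ℝ) : ℂ) -
    (m : ℂ) * ((Kerr.starAngle M a r : ℝ) : ℂ)))) with hPdef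
  set K : ℝ → ℂ := fun r ↦ w * (((r ^ 2 + a ^ 2 : ℝ)) : ℂ) - (m : ℂ) * (a : ℂ) with hKdef
  have hPd : ∀ r, rp < r → HasDerivAt P (P r * (-(Complex.I * K r) / ((Kerr.delta M a r : ℝ) : ℂ))) r := by
    intro r hr
    have hΔ : ((Kerr.delta M a r : ℝ) : ℂ) ≠ 0 := Complex.ofReal_ne_zero.2 (Kerr.delta_pos hMa.le hr).ne'
    have h1 := (Kerr.hasDerivAt_starTime hMa hr).ofReal_comp
    have h2 := (Kerr.hasDerivAt_starAngle hMa hr).ofReal_comp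
    have h3 := ((h1.const_mul w).sub (h2.const_mul (m : ℂ))).const_mul Complex.I
    have h4 := h3.neg.cexp
    refine h4.congr_deriv ?_
    simp only [hPdef, hKdef, Pi.neg_apply, Pi.sub_apply]
    push_cast
    field_simp
  have hfd : ∀ r, rp < r → HasDerivAt f (deriv f r) r := fun r hr ↦
    ((hf.differentiableOn one_ne_zero).differentiableAt (Ioi_mem_nhds (by linarith))).hasDerivAt
  have hRd : ∀ r, rp < r → deriv R r =
      P r * (-(Complex.I * K r) / ((Kerr.delta M a r : ℝ) : ℂ)) * f r + P r * deriv f r := by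
    intro r hr
    have heq : R =ᶠ[𝓝 r] fun s ↦ P s * f s := by
      filter_upwards [Ioi_mem_nhds hr] with s hs using hRf s hs
    rw [heq.deriv_eq]
    exact ((hPd r hr).mul (hfd r hr)).deriv
  -- `|P|² = 1` for real `ω`
  have hP1 : ∀ r, ((‖P r‖ ^ 2 : ℝ) : ℂ) = 1 := by
    intro r
    have h := norm_sq_horizonPhase w m (Kerr.starTime M a r) (Kerr.starAngle M a r)
    simp only [hPdef]
    rw [h, hw, mul_zero, zero_mul, Real.exp_zero]
    norm_num
  -- the identity `Δ R' R̄ = (Δ f' - iK f) f̄` on `(r₊, ∞)`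
  set B : ℝ → ℂ := fun r ↦ (((Kerr.delta M a r : ℝ) : ℂ) * deriv f r - Complex.I * K r * f r) *
    conj (f r) with hBdef
  have hid : ∀ r, rp < r → ((Kerr.delta M a r : ℝ) : ℂ) * deriv R r * conj (R r) = B r := by
    intro r hr
    have hΔ : ((Kerr.delta M a r : ℝ) : ℂ) ≠ 0 := Complex.ofReal_ne_zero.2 (Kerr.delta_pos hMa.le hr).ne'
    have hPP : P r * conj (P r) = 1 := by
      rw [Complex.mul_conj, Complex.normSq_eq_norm_sq, ← hP1 r]
    have : ((Kerr.delta M a r : ℝ) : ℂ) * deriv R r * conj (R r) =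
        (P r * conj (P r)) * B r := by
      rw [hRd r hr, hRf r hr, map_mul]
      simp only [hBdef]
      field_simp
      ring
    rw [this, hPP, one_mul]
  -- `B` is continuous at `r₊` with the asserted value
  have hcf : ContinuousAt f rp := hf.continuousOn.continuousAt (Ioi_mem_nhds (by linarith))
  have hcf' : ContinuousAt (deriv f) rp :=
    (hf.continuousOn_deriv_of_isOpen isOpen_Ioi le_rfl).continuousAt (Ioi_mem_nhds (by linarith))
  have hΔc : Continuous fun r : ℝ ↦ ((Kerr.delta M a r : ℝ) : ℂ) := by unfold Kerr.delta; fun_prop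
  have hKc : Continuous K := by simp only [hKdef]; fun_prop
  have hBc : ContinuousAt B rp := by
    simp only [hBdef]
    exact ((hΔc.continuousAt.mul hcf').sub ((continuousAt_const.mul hKc.continuousAt).mul hcf)).mul
      hcf.star
  have hBval : B rp = -(Complex.I * (w * (((rp ^ 2 + a ^ 2 : ℝ)) : ℂ) - (m : ℂ) * (a : ℂ))) *
      ((‖f rp‖ ^ 2 : ℝ) : ℂ) := by
    have hff : f rp * conj (f rp) = ((‖f rp‖ ^ 2 : ℝ) : ℂ) := by
      rw [Complex.mul_conj, Complex.normSq_eq_norm_sq]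
    simp only [hBdef, hKdef, hrp, Kerr.delta_rPlus hMa.le]
    rw [← hff]
    push_cast
    ring
  have hlim : Tendsto B (𝓝[>] rp) (𝓝 (B rp)) := hBc.tendsto.mono_left nhdsWithin_le_nhds
  rw [hBval] at hlim
  refine hlim.congr' ?_
  filter_upwards [self_mem_nhdsWithin] with r hr using (hid r hr).symm

/-- **The horizon value of the energy current** (SR §3.1): for real `ω` and `R` of the horizon
form (2.3), `Q_T = Im(Δ R' R̄) → (am − 2Mr₊ω)|f(r₊)|²` as `r → r₊⁺` (`r₊² + a² = 2Mr₊`).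
[cite: ShlapentokhRothman2014KleinGordon, §3.1] -/
theorem tendsto_im_horizonFlux_of_horizonForm_real (hMa : Kerr.IsSubextremal M a) {w : ℂ}
    (hw : w.im = 0) (m : ℤ) {R f : ℝ → ℂ} {η : ℝ} (hη : 0 < η)
    (hf : ContDiffOn ℝ 1 f (Ioi (Kerr.rPlus M a - η)))
    (hRf : ∀ r ∈ Ioi (Kerr.rPlus M a), R r =
      Complex.exp (-(Complex.I * (w * ((Kerr.starTime M a r : ℝ) : ℂ) -
        (m : ℂ) * ((Kerr.starAngle M a r : ℝ) : ℂ)))) * f r) :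
    Tendsto (fun r : ℝ ↦ (((Kerr.delta M a r : ℝ) : ℂ) * deriv R r * conj (R r)).im)
      (𝓝[>] (Kerr.rPlus M a))
      (𝓝 ((a * m - 2 * M * Kerr.rPlus M a * w.re) * ‖f (Kerr.rPlus M a)‖ ^ 2)) := by
  have h := (Complex.continuous_im.tendsto _).comp
    (tendsto_horizonFlux_of_horizonForm_real hMa hw m hη hf hRf)
  have hsq : Kerr.rPlus M a ^ 2 + a ^ 2 = 2 * M * Kerr.rPlus M a := by
    have := hMa.rPlus_sq; linarith
  have h2 : Tendsto (fun r : ℝ ↦ (((Kerr.delta M a r : ℝ) : ℂ) * deriv R r * conj (R r)).im)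
      (𝓝[>] (Kerr.rPlus M a))
      (𝓝 ((-(Complex.I * (w * (((Kerr.rPlus M a ^ 2 + a ^ 2 : ℝ)) : ℂ) - (m : ℂ) * (a : ℂ))) *
        ((‖f (Kerr.rPlus M a)‖ ^ 2 : ℝ) : ℂ)).im)) := h
  have hval : (-(Complex.I * (w * (((Kerr.rPlus M a ^ 2 + a ^ 2 : ℝ)) : ℂ) - (m : ℂ) * (a : ℂ))) *
        ((‖f (Kerr.rPlus M a)‖ ^ 2 : ℝ) : ℂ)).im =
      (a * m - 2 * M * Kerr.rPlus M a * w.re) * ‖f (Kerr.rPlus M a)‖ ^ 2 := by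
    rw [hsq]
    simp only [Complex.neg_im, Complex.mul_im, Complex.mul_re, Complex.I_re, Complex.I_im,
      Complex.sub_re, Complex.sub_im, Complex.ofReal_re, Complex.ofReal_im, Complex.intCast_re,
      Complex.intCast_im, hw]
    ring
  rw [hval] at h2
  exact h2

end Literature.Barriers.FinalStateConjecture

end
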